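import Mathlib
import Summits.ResolutionOfSingularities.ResolutionOfSingularities.Theorems.WildQuotientsWildQuotientResolutionJordanThreeOrder

/-!
# V3U-A1: the Jordan block `J₃` (with passengers) has order `p` in every characteristic `p ≥ 3`

(crux stmt-ResolutionOfSingularities-15640 `WildQuotients.WildQuotientResolution`, line `Sketch`,
sector `|G| = p`; programme V3U of `L/w45c/CHAIN.md` v5, candidate A1 `v3_order` of
`L/w45c/W45cPlanSignaturesV5.lean` §A VERBATIM. [OURS · L1 W4.5c] — NOT a statement of any manuscript;
replaces the role of no printed item. Prover res-L1-w45c-stub-4.)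

For the `J₃` datum `σ x_b = x_b + x_a`, `σ x_c = x_c + x_b`, identity on the other coordinates
(`a, b, c` distinct), `σᵐ x_c = x_c + m x_b + C(m,2) x_a` (`JordanThree.pow_apply_X_c`, p478157); at
`m = p` both `p` and `C(p,2) = p(p−1)/2` vanish in characteristic `p` as soon as `p ≥ 3` (for `p = 2`
the order is `4`).
-/

-- single-problem summit: the doubled namespace component `ResolutionOfSingularities` is forced
set_option linter.dupNamespace false

noncomputable section

open MvPolynomial

namespace Summit.ResolutionOfSingularities.ResolutionOfSingularities.Theorems.WildQuotientResolution.JordanThree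

/-- **`σ ^ p = 1`** for the `J₃` datum in characteristic `p ≥ 3` (`p ∣ C(p,2)` for `2 < p`). [folklore] -/
theorem pow_prime_eq_one (p : ℕ) (hp : p.Prime) (hp3 : 3 ≤ p) (k : Type) [Field k] [CharP k p]
    (n : ℕ) (σ : MvPolynomial (Fin n) k ≃ₐ[k] MvPolynomial (Fin n) k) (a b c : Fin n)
    (hab : a ≠ b) (hac : a ≠ c)
    (hb : σ (X b) = X b + X a) (hc : σ (X c) = X c + X b)
    (hσ : ∀ i, i ≠ b → i ≠ c → σ (X i) = X i) :
    σ ^ p = 1 := by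
  classical
  have hp0 : ((p : ℕ) : MvPolynomial (Fin n) k) = 0 := CharP.cast_eq_zero _ p
  have hp2 : (((p : ℕ).choose 2 : ℕ) : MvPolynomial (Fin n) k) = 0 :=
    (CharP.cast_eq_zero_iff (MvPolynomial (Fin n) k) p _).2
      (hp.dvd_choose_self two_ne_zero (by omega))
  have key : ((σ ^ p : MvPolynomial (Fin n) k ≃ₐ[k] MvPolynomial (Fin n) k) :
      MvPolynomial (Fin n) k →ₐ[k] MvPolynomial (Fin n) k) = AlgHom.id k _ := by
    refine MvPolynomial.algHom_ext fun i => ?_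
    change (σ ^ p) (X i) = X i
    by_cases hib : i = b
    · subst hib
      rw [pow_apply_X_b k n σ a i c hab hac hb hσ p, hp0, zero_mul, add_zero]
    by_cases hic : i = c
    · subst hic
      rw [pow_apply_X_c k n σ a b i hab hac hb hc hσ p, hp0, hp2, zero_mul, zero_mul, add_zero,
        add_zero]
    · exact pow_apply_X_of_ne k n σ b c hσ p i hib hic
  apply AlgEquiv.ext
  intro r
  have := DFunLike.congr_fun key r
  simpa using this

/-- **`|⟨σ⟩| = p`** for the `J₃` datum in characteristic `p ≥ 3`. [folklore] -/
theorem card_zpowers_prime (p : ℕ) (hp : p.Prime) (hp3 : 3 ≤ p) (k : Type) [Field k] [CharP k p]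
    (n : ℕ) (σ : MvPolynomial (Fin n) k ≃ₐ[k] MvPolynomial (Fin n) k) (a b c : Fin n)
    (hab : a ≠ b) (hac : a ≠ c)
    (hb : σ (X b) = X b + X a) (hc : σ (X c) = X c + X b)
    (hσ : ∀ i, i ≠ b → i ≠ c → σ (X i) = X i) :
    Nat.card (Subgroup.zpowers σ) = p := by
  haveI : Fact p.Prime := ⟨hp⟩
  rw [Nat.card_zpowers, orderOf_eq_prime (pow_prime_eq_one p hp hp3 k n σ a b c hab hac hb hc hσ)
    (ne_one k n σ a b hb)]

/-- **V3U-A1 `v3_order`** (candidate A1 of `W45cPlanSignaturesV5.lean` §A, signature verbatim;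
[OURS · L1 W4.5c]): the `J₃` datum has `σ ^ p = 1` and `σ ≠ 1` over any field of characteristic
`p ≥ 3`. The hypothesis `b ≠ c` is part of the registered law and is not needed for the conclusion.
[folklore] -/
theorem v3_order (p : ℕ) (hp : p.Prime) (hp3 : 3 ≤ p) (k : Type) [Field k] [CharP k p] (n : ℕ)
    (σ : MvPolynomial (Fin n) k ≃ₐ[k] MvPolynomial (Fin n) k) (a b c : Fin n)
    (hab : a ≠ b) (_hbc : b ≠ c) (hac : a ≠ c)
    (hb : σ (X b) = X b + X a) (hc : σ (X c) = X c + X b)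
    (hσ : ∀ i, i ≠ b → i ≠ c → σ (X i) = X i) :
    σ ^ p = 1 ∧ σ ≠ 1 :=
  ⟨pow_prime_eq_one p hp hp3 k n σ a b c hab hac hb hc hσ, ne_one k n σ a b hb⟩

end Summit.ResolutionOfSingularities.ResolutionOfSingularities.Theorems.WildQuotientResolution.JordanThree

end
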